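import Summits.HodgeConjecture.CorCM.D2Bridge.ClosedPrintedMuKeyIdentLemD3DelRecConjOmegaT
import Summits.HodgeConjecture.HodgeConjecture.Theses.HCCMUnconditional
import Summits.HodgeConjecture.CorCM.HypD3.A4LiuD3Items
import Summits.HodgeConjecture.CorCM.HypD3.A4LiuD3SameClassChiNonsplit
import Summits.HodgeConjecture.CorCM.HypD3.A4LiuD3SameClassOfSplit
import Summits.HodgeConjecture.CorCM.HypD3.A4LiuD3MuOfIsoNonsplitOfFacts
import Summits.HodgeConjecture.CorCM.HypD3.A4LiuD3SplitInjectiveOfFacts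
import Summits.HodgeConjecture.CorCM.HypD3.A4LiuD3KudlaOfLineRigidity
import Summits.HodgeConjecture.CorCM.HypD3.A4LiuD3IsoOfParamsOfLineRigidity
import Literature.NumberTheory.Automorphic.Liu2021.SplitPlaceOscillatorModelUniform
import Literature.NumberTheory.Automorphic.Zelevinsky1980.UnitaryCharacterInductionIrreducible
import Literature.RepresentationTheory.MoeglinVignerasWaldspurger1987.RankOneThetaLiftTwistRigiditySplitHolds
import Summits.HodgeConjecture.CorCM.B01.Transposition.Item6OmegaChiSplitting
import Literature.NumberTheory.Automorphic.Liu2021.Def411WeilCarriersLocalDataAtV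
import Literature.NumberTheory.Automorphic.IdeleClassCharacterHecke
import Literature.RepresentationTheory.Liu2021.OscillatorConventions
import Literature.NumberTheory.GelbartRogawski1991.CMSplittingCharLocalMu
import HarnessLib

/-!
# `HCCMUnconditional.HD3` from its residual facts — the closing-file HEAD for item stmt-HodgeConjecture-24837 (binder `hD3`,
# [Liu 2021, App. D Lem. D.1 (3)] AS PRINTED, per finite place, `n = 3`)

Topic: summit `HodgeConjecture`, sub-problem `HodgeConjecture`, route `HCCMUnconditional`, crux `HD3` (= the pack decl
`PrintedCitationHypotheses.HypD3` by `rfl`).  PROVER FILE (cell hodgecm-mathlib, seat B-p19; `--supports stmt-HodgeConjecture-24837`): sorry-free, axioms ⊆ trio.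

It is A-plan2's line `a4-liuD3` (v2/v3; §3 `lemD1_3AsPrintedI_famAtV_of` and §4 `HypD3_of`, character for character) with every CLOSED stub replaced BY NAME by its
landed discharge and the OPEN ones left as explicit hypotheses, so that the closing file of the item is the ONE-LINER
`HD3_proof := hypD3_of_facts hK_holds isoOfParams_holds rankOne_theta_lines_disjoint_holds rankOne_theta_twist_rigidity_holds` the day those land:
* «⇒ ε-class ∧ χ, non-split» := A-p05's `HypD3.sameClassChiOfIsoNonsplit` (p602107);
* «⇒ μ, non-split» := B-p14's `HypD3.muOfIsoNonsplit_of_facts` (p603508), modulo the hypothesis `hK` below;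
* «⇒ μ ∧ χ, split» := B-p18's `HypD3.splitInjective_of_facts` (p602388) fed with IV-4(c4) `rankOne_theta_twist_rigidity_split_holds` (B-p17, over B-p08's
  `splitPlace_chiCoinv_iso_parabolicIndGL_uniform`), IV-3(a) `Liu2021.splitPlace_chiCoinv_iso_parabolicIndGL_holds` (B-p08), IV-3(b)
  `Zelevinsky1980.parabolicIndGL_detChar_unitary_isIrreducible_holds` (B-p09/B-p11/B-p17), modulo `hK`;
* «⇒ ε-class, split» := B-p18's `HypD3.sameClassOfSplit` (p600298) at `e₁`.
RESIDUAL HYPOTHESES (exactly four, all named in the line): `hK` = the line's registered `KudlaTransportedSectionEq` (Kudla's splitting uniqueness in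
transported form, the common hypothesis `∀ i j, hK i j` of p603508/p602388; owners B-p13/B-p14 S6a–c), spelled out verbatim as a binder type (the line's
`def` is not yet a tree decl); `hS6a : IsoOfParams` (the line's stub :203, «⇐», owners B-p13/B-p02); IV-4(c1) `rankOne_theta_lines_disjoint` (A-p15 crew);
IV-4(c3) `rankOne_theta_twist_rigidity` (WALL J7 booked).  HC_CM is proved only modulo the 7 printed citations until rung 0 closes; this file discharges no
binder by itself.

## References
* [Liu2021] Y. Liu, Camb. J. Math. 9 (2021) = arXiv:2102.11518, App. D Lem. D.1 (3) (l. 5233), proof l. 5253–5255; §D.1 Steps 1–3.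
* [MoeglinVignerasWaldspurger1987] LNM 1291, Chap. 3 IV.4.  [Kudla1994] Thm 3.1.  [Minguez2008] Thm 1.  [Zelevinsky1980] Thm 4.2.
-/

set_option autoImplicit false

-- `Summit.HodgeConjecture.HodgeConjecture.…` is the mandated summit namespace (Problem = Summit), which `linter.dupNamespace` flags; the lakefile turns the
-- linter off tree-wide (weak option), restated here so stand-alone elaboration is warning-free too.
set_option linter.dupNamespace false

noncomputable section

namespace Summit.HodgeConjecture.CorCM.HypD3

open Summit.HodgeConjecture.CorCM.Lines.A4LiuD3 (famAtV SameClassChiOfIsoNonsplit MuOfIsoNonsplit SplitInjective SameClassOfSplit IsoOfParams)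
open scoped TensorProduct Matrix
open NumberField NumberField.InfinitePlace
open HodgeCM.Model HodgeCM.Model.LiuIndex HodgeCM.Model.TowerCarrier
open HodgeCM.Literature.Theta.LiuAlbaneseModuleDatum.D2Bridge (HcmPieces)
open Summit.HodgeConjecture.CorCM.Model
open Literature.AlgebraicGeometry.Motives (CMType)
open Literature.AlgebraicGeometry.HodgeTheory Literature.NumberTheory.Automorphic.PicardCM
open Literature.AlgebraicGeometry.ShimuraVarieties.UnitaryCanonicalModel
open Literature.NumberTheory.ComplexMultiplication
open Literature.NumberTheory.Automorphic
open Literature.NumberTheory.Automorphic.IdeleClassGroup (toHeckeCharacter isUnitary_toHeckeCharacter galConj)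
open Literature.NumberTheory.Automorphic.Liu2021 Literature.NumberTheory.Automorphic.Liu2021.AppendixC
open Literature.NumberTheory.Automorphic.Liu2021.AppendixC.RestOne
open Literature.NumberTheory.Automorphic.Liu2021.Def411WeilCarriers (lineOf locF Rep)
open Summit.HodgeConjecture.CorCM.Transposition.OmegaTransport (realUnit)
open HodgeCM.Model.ArchSideTerm (e₁)
open Literature.NumberTheory.GelbartRogawski1991 Literature.NumberTheory.GelbartRogawski1991.UnitaryDualPair
open Literature.NumberTheory.GelbartRogawski1991.UnitaryDualPair.LocalSplitting (localMu norm_localMu continuous_localMu localMu_toLocalRing_eq_one_iff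
  eq_of_forall_localMu_toHeckeCharacter_eq)
open Literature.RepresentationTheory Literature.RepresentationTheory.Liu2021
open Summit.HodgeConjecture.CorCM.Transposition
open Literature.RepresentationTheory.MoeglinVignerasWaldspurger1987 (rankOne_theta_lines_disjoint rankOne_theta_twist_rigidity rankOne_theta_twist_rigidity_split
  lineTransportSplitting)
open Literature.NumberTheory.GelbartRogawski1991.UnitaryDualPair.LocalSplitting (lineTransportSection conj_lineDelta lineDelta_ne_zero lineDelta_mul_self)
open Summit.HodgeConjecture.CorCM.D2Bridge.AdapterMuConj (muConj prop413AsPrinted_muConj def411_muConj nontrivial_omegaAt_muConj_rest)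
open Summit.HodgeConjecture.CorCM.D2Bridge.MuKeyIdentEnd (hc_cm_of_printed_citations_muKey_ident)
open Summit.HodgeConjecture.CorCM.D2Bridge.MuKeyIdentLemD3End
open Summit.HodgeConjecture.CorCM.D2Bridge.MuKeyIdentLemD3DelRecConjOmegaEnd (diagonal_frameD_map_complexConj)
open Summit.HodgeConjecture.CorCM.D2Bridge.MuKeyIdentLemD3DelRecConjOmegaEndT (hc_cm_of_printed_citations_muKey_ident_lemD3_delRecConjOmegaT)
open MeasureTheory

-- heartbeats as in the line's §3 (A-plan2 a4-liuD3 v2): the five `have`s over the spelled family exceed the default budget.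
set_option maxHeartbeats 2000000 in
/-- **the five thirds + the three IV-4(c) facts ⇒ [Lem. D.1 (3)] AS PRINTED on `famAtV … e₁ … v`**, by `by_cases hE : IsField (F ⊗ F⁺_v)` — the line's
§3 `lemD1_3AsPrintedI_famAtV_of`, verbatim (kernel-checked composition). [cite: Liu2021, App. D Lem. D.1 (3) (l. 5233)] -/
theorem lemD1_3AsPrintedI_famAtV_of_facts (s₁ : SameClassChiOfIsoNonsplit) (s₂ : MuOfIsoNonsplit) (s₃ : SplitInjective) (s₄ : SameClassOfSplit)
    (s₅ : IsoOfParams) (hc1 : Literature.RepresentationTheory.MoeglinVignerasWaldspurger1987.rankOne_theta_lines_disjoint)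
    (hc3 : Literature.RepresentationTheory.MoeglinVignerasWaldspurger1987.rankOne_theta_twist_rigidity)
    (hc4 : Literature.RepresentationTheory.MoeglinVignerasWaldspurger1987.rankOne_theta_twist_rigidity_split)
    (F : HodgeCM.CMField) (dV : Fin 3 → (F : Type))
      (hdV : ∀ i, IsCMField.complexConj (F : Type) (dV i) = dV i) (hdV0 : ∀ i, dV i ≠ 0) {ι : Type}
      (ψ : ι → (Literature.NumberTheory.Automorphic.IdeleClassGroup (F : Type) →ₜ* Circle))
      (hψ : ∀ t, IdeleClassGroup.IsConjugateSymplectic (F : Type) (ψ t))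
      (aOf : ι → (↥(maximalRealSubfield (F : Type)))ˣ)
      (χOf : ι → Def411WeilCarriers.Chi ↥(maximalRealSubfield (F : Type)) (F : Type) (IsCMField.complexConj (F : Type)))
      (v : IsDedekindDomain.HeightOneSpectrum (𝓞 ↥(maximalRealSubfield (F : Type)))) :
    LemD1_3AsPrintedI (famAtV F e₁ dV hdV hdV0 ψ hψ aOf χOf v) := by
  have h₁ := s₁ hc1 F dV hdV hdV0 ψ hψ aOf χOf v
  have h₂ := s₂ hc1 hc3 F dV hdV hdV0 ψ hψ aOf χOf v
  have h₃ := s₃ hc4 F dV hdV hdV0 ψ hψ aOf χOf v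
  have h₄ := @s₄ F dV hdV hdV0 ι ψ hψ aOf χOf v
  have h₅ := @s₅ F dV hdV hdV0 ι ψ hψ aOf χOf v
  intro _ i j
  refine ⟨fun h => ?_, fun h => h₅ i j h.1 h.2.1 h.2.2⟩
  by_cases hE : IsField (UnitaryGroup.LocalRing (F : Type) v)
  · exact ⟨h₂ hE i j h, (h₁ hE i j h).1, (h₁ hE i j h).2⟩
  · exact ⟨(h₃ hE i j h).1, h₄ hE i j, (h₃ hE i j h).2⟩

open Summit.HodgeConjecture.CorCM.D2Bridge.MuKeyIdentLemD3DelRecConjOmegaEndT.PrintedCitationHypotheses (HypD3)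

-- heartbeats as in the line's §4 head `HypD3_of` (A-plan2 a4-liuD3 v2): one monolithic `exact` over the Thm-4.18 datum.
set_option maxHeartbeats 4000000 in
/-- **`hypD3_of_facts` — the route item `HCCMUnconditional.HD3` (= `PrintedCitationHypotheses.HypD3`, [Liu2021, App. D Lem. D.1 (3)] AS PRINTED per finite
place) FROM ITS FOUR RESIDUAL FACTS**: `hK` (the line's `KudlaTransportedSectionEq`, spelled out), `hS6a : IsoOfParams`, IV-4(c1) and IV-4(c3); everything else
by name (module docstring).  The line's §4 head `HypD3_of` with the closed stubs substituted.  Closing-file head for item stmt-HodgeConjecture-24837.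
[cite: Liu2021, App. D Lem. D.1 (3) (l. 5233), proof l. 5253–5255] -/
theorem hypD3_of_facts
    (hK :
    ∀ (F : HodgeCM.CMField) (dV : Fin 3 → (F : Type))
        (hdV : ∀ i, IsCMField.complexConj (F : Type) (dV i) = dV i) (hdV0 : ∀ i, dV i ≠ 0) {ι : Type}
        (ψ : ι → (Literature.NumberTheory.Automorphic.IdeleClassGroup (F : Type) →ₜ* Circle))
        (hψ : ∀ t, IdeleClassGroup.IsConjugateSymplectic (F : Type) (ψ t))
        (aOf : ι → (↥(maximalRealSubfield (F : Type)))ˣ)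
        (χOf : ι → Def411WeilCarriers.Chi ↥(maximalRealSubfield (F : Type)) (F : Type) (IsCMField.complexConj (F : Type)))
        (v : IsDedekindDomain.HeightOneSpectrum (𝓞 ↥(maximalRealSubfield (F : Type)))),
        ∀ i j : ι,
          (∃ (x : (UnitaryGroup.LocalRing (F : Type) v)ˣ) (hx : algebraMap (F : Type) (UnitaryGroup.LocalRing (F : Type) v) (algebraMap ↥(maximalRealSubfield (F : Type)) (F : Type) (↑(aOf j)⁻¹ : ↥(maximalRealSubfield (F : Type))) * imagUnit (F : Type)) =
              (x : (UnitaryGroup.LocalRing (F : Type) v)) * UnitaryGroup.conjLocal (F : Type) (IsCMField.complexConj (F : Type)) v x * algebraMap (F : Type) (UnitaryGroup.LocalRing (F : Type) v) (algebraMap ↥(maximalRealSubfield (F : Type)) (F : Type) (↑(aOf i)⁻¹ : ↥(maximalRealSubfield (F : Type))) * imagUnit (F : Type))),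
            lineTransportSplitting (F : Type) v (IsCMField.complexConj (F : Type)) 3 (conj_lineDelta (complexConj_imagUnit (F : Type)) (aOf i)) (lineDelta_ne_zero (imagUnit_ne_zero (F : Type)) (aOf i))
              (lineDelta_mul_self (imagUnit_mul_self (F : Type)) (aOf i)) (conj_lineDelta (complexConj_imagUnit (F : Type)) (aOf j)) (lineDelta_ne_zero (imagUnit_ne_zero (F : Type)) (aOf j))
              (lineDelta_mul_self (imagUnit_mul_self (F : Type)) (aOf j)) x (realDiagonal (F : Type) dV hdV) (realDiagonal_isSymm (F : Type) dV hdV) (isUnit_det_realDiagonal (F : Type) dV hdV hdV0) hx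
              (lineTransportSection ↥(maximalRealSubfield (F : Type)) (F : Type) (IsCMField.complexConj (F : Type)) 3 (complexConj_imagUnit (F : Type)) (imagUnit_ne_zero (F : Type)) (imagUnit_mul_self (F : Type)) (realDiagonal (F : Type) dV hdV) (realDiagonal_isSymm (F : Type) dV hdV) (Matrix.diagonal dV) (realDiagonal_map (F : Type) dV hdV).symm (aOf i) v ((OmegaChiSplitting.chiLocalSplittingsD ⟨HodgeCM.CMField.K F⟩ e₁ dV hdV hdV0 (toHeckeCharacter (F : Type) (ψ i)) ((isOscillatorChar_toHeckeCharacter_iff (ψ i)).mpr (hψ i)) (aOf i)).s v) ((OmegaChiSplitting.chiLocalSplittingsD ⟨HodgeCM.CMField.K F⟩ e₁ dV hdV hdV0 (toHeckeCharacter (F : Type) (ψ i)) ((isOscillatorChar_toHeckeCharacter_iff (ψ i)).mpr (hψ i)) (aOf i)).proj_s v)) =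
            (lineTransportSection ↥(maximalRealSubfield (F : Type)) (F : Type) (IsCMField.complexConj (F : Type)) 3 (complexConj_imagUnit (F : Type)) (imagUnit_ne_zero (F : Type)) (imagUnit_mul_self (F : Type)) (realDiagonal (F : Type) dV hdV) (realDiagonal_isSymm (F : Type) dV hdV) (Matrix.diagonal dV) (realDiagonal_map (F : Type) dV hdV).symm (aOf j) v ((OmegaChiSplitting.chiLocalSplittingsD ⟨HodgeCM.CMField.K F⟩ e₁ dV hdV hdV0 (toHeckeCharacter (F : Type) (ψ j)) ((isOscillatorChar_toHeckeCharacter_iff (ψ j)).mpr (hψ j)) (aOf j)).s v) ((OmegaChiSplitting.chiLocalSplittingsD ⟨HodgeCM.CMField.K F⟩ e₁ dV hdV hdV0 (toHeckeCharacter (F : Type) (ψ j)) ((isOscillatorChar_toHeckeCharacter_iff (ψ j)).mpr (hψ j)) (aOf j)).proj_s v))) →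
          localMu (F : Type) (toHeckeCharacter (F : Type) (ψ j)) v = localMu (F : Type) (toHeckeCharacter (F : Type) (ψ i)) v)
    (hS6a : IsoOfParams) (hc1 : Literature.RepresentationTheory.MoeglinVignerasWaldspurger1987.rankOne_theta_lines_disjoint)
    (hc3 : Literature.RepresentationTheory.MoeglinVignerasWaldspurger1987.rankOne_theta_twist_rigidity) :
    Summit.HodgeConjecture.HodgeConjecture.Theses.HCCMUnconditional.HD3 := by
  intro hDel F _ h6 ι₁ V a Φ hΦ v
  exact lemD1_3AsPrintedI_famAtV_of_facts
      Summit.HodgeConjecture.CorCM.HypD3.sameClassChiOfIsoNonsplit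
      (fun h41 h43 F dV hdV hdV0 {ι} ψ hψ aOf χOf v =>
        Summit.HodgeConjecture.CorCM.HypD3.muOfIsoNonsplit_of_facts h41 h43 F dV hdV hdV0 ψ hψ aOf χOf v (hK F dV hdV hdV0 ψ hψ aOf χOf v))
      (fun h4 F dV hdV hdV0 {ι} ψ hψ aOf χOf v =>
        Summit.HodgeConjecture.CorCM.HypD3.splitInjective_of_facts h4
          Literature.NumberTheory.Automorphic.Liu2021.splitPlace_chiCoinv_iso_parabolicIndGL_holds
          Literature.NumberTheory.Automorphic.Zelevinsky1980.parabolicIndGL_detChar_unitary_isIrreducible_holds.{0}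
          F dV hdV hdV0 ψ hψ aOf χOf v (hK F dV hdV hdV0 ψ hψ aOf χOf v))
      (fun F => Summit.HodgeConjecture.CorCM.HypD3.sameClassOfSplit F e₁)
      hS6a hc1 hc3 Literature.RepresentationTheory.MoeglinVignerasWaldspurger1987.rankOne_theta_twist_rigidity_split_holds
      F (frameD V) (frameD_real V) (frameD_ne V)
    (fun t : ((μw : {μ : Literature.NumberTheory.Automorphic.IdeleClassGroup (F : Type) →ₜ* Circle // IdeleClassGroup.IsConjugateSymplectic (F : Type) μ ∧ IdeleClassGroup.HasWeight (F : Type) μ 1}) × (toThm418Data _ (restOfCharDeltaPrime (Summit.HodgeConjecture.CorCM.DelRec.exists_recordSystem_of_printed hDel) ⟨HodgeCM.CMField.K F⟩ h6 ι₁ ⟨HodgeCM.HermSpace3.Hm V, HodgeCM.HermSpace3.isHermitian V, HodgeCM.HermSpace3.signature_ι₁ V, HodgeCM.HermSpace3.posDef_of_ne V⟩ Φ e₁ (frameD V) (frameD_real V) (frameD_ne V) (ιVE V) (Rep.update ↥(maximalRealSubfield (HodgeCM.CMField.K F)) (imagUnitSq (HodgeCM.CMField.K F)) (Rep.ofLineOf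 ↥(maximalRealSubfield (HodgeCM.CMField.K F)) (imagUnitSq (HodgeCM.CMField.K F))) (locF ↥(maximalRealSubfield (HodgeCM.CMField.K F)) (imagUnitSq (HodgeCM.CMField.K F)) (realUnit ⟨HodgeCM.CMField.K F⟩ a.1 a.2.1 a.2.2)) (realUnit ⟨HodgeCM.CMField.K F⟩ a.1 a.2.1 a.2.2) rfl) μw.1 μw.2.1 μw.2.2)).AdmIndex) => t.1.1) (fun t => t.1.2.1)
    (fun t => (Rep.update ↥(maximalRealSubfield (HodgeCM.CMField.K F)) (imagUnitSq (HodgeCM.CMField.K F)) (Rep.ofLineOf ↥(maximalRealSubfield (HodgeCM.CMField.K F)) (imagUnitSq (HodgeCM.CMField.K F))) (locF ↥(maximalRealSubfield (HodgeCM.CMField.K F)) (imagUnitSq (HodgeCM.CMField.K F)) (realUnit ⟨HodgeCM.CMField.K F⟩ a.1 a.2.1 a.2.2)) (realUnit ⟨HodgeCM.CMField.K F⟩ a.1 a.2.1 a.2.2) rfl).toFun t.2.1.1)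
    (fun t => t.2.1.2) v

/-! ## Appended (line a4-liuD3 v4, A-plan2 2026-08-28): the head over the THREE v4 residuals S6a / IV-4(c1) / IV-4(c3) -/

-- heartbeats: the spelled `LineRigidityS6a` binder type is large (the line's v4 :153 uses `maxHeartbeats 1600000` for it).
set_option maxHeartbeats 1600000 in
/-- **`hD3_of_lineRigidityS6a` — `HCCMUnconditional.HD3` from S6a + IV-4(c1) + IV-4(c3)** (line a4-liuD3 v4: «hD3 =
LineRigidityS6a + c1 + c3 exactly»): `hypD3_of_facts` with its `hK` antecedent discharged place-free by B-p18's
`HypD3.kudla_of_lineRigidity` (p605088) and `IsoOfParams` by B-p09's `HypD3.isoOfParams_of_lineRigidityS6a` (p605777), both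
from the line-rigidity identity `hS6a` = the line's registered `LineRigidityS6a` (v4 :153), spelled verbatim as a binder
type.  The closing file is then `HD3_proof := hD3_of_lineRigidityS6a stub_lineRigidityS6a ‹c1› ‹c3›`.
[cite: Liu2021, App. D Lem. D.1 (3) (l. 5233), proof l. 5253–5255] [cite: Kudla1994, §3 Thm. 3.1] -/
theorem hD3_of_lineRigidityS6a
    (hS6a :
    ∀ (F : HodgeCM.CMField) (dV : Fin 3 → (F : Type))
        (hdV : ∀ i, IsCMField.complexConj (F : Type) (dV i) = dV i) (hdV0 : ∀ i, dV i ≠ 0) {ι : Type}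
        (ψ : ι → (Literature.NumberTheory.Automorphic.IdeleClassGroup (F : Type) →ₜ* Circle))
        (hψ : ∀ t, IdeleClassGroup.IsConjugateSymplectic (F : Type) (ψ t))
        (aOf : ι → (↥(maximalRealSubfield (F : Type)))ˣ)
        (v : IsDedekindDomain.HeightOneSpectrum (𝓞 ↥(maximalRealSubfield (F : Type)))),
        ∀ i j : ι,
          ∀ (x : (UnitaryGroup.LocalRing (F : Type) v)ˣ) (hx : algebraMap (F : Type) (UnitaryGroup.LocalRing (F : Type) v) (algebraMap ↥(maximalRealSubfield (F : Type)) (F : Type) (↑(aOf j)⁻¹ : ↥(maximalRealSubfield (F : Type))) * imagUnit (F : Type)) =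
              (x : (UnitaryGroup.LocalRing (F : Type) v)) * UnitaryGroup.conjLocal (F : Type) (IsCMField.complexConj (F : Type)) v x * algebraMap (F : Type) (UnitaryGroup.LocalRing (F : Type) v) (algebraMap ↥(maximalRealSubfield (F : Type)) (F : Type) (↑(aOf i)⁻¹ : ↥(maximalRealSubfield (F : Type))) * imagUnit (F : Type))),
            lineTransportSplitting (F : Type) v (IsCMField.complexConj (F : Type)) 3 (conj_lineDelta (complexConj_imagUnit (F : Type)) (aOf i)) (lineDelta_ne_zero (imagUnit_ne_zero (F : Type)) (aOf i))
              (lineDelta_mul_self (imagUnit_mul_self (F : Type)) (aOf i)) (conj_lineDelta (complexConj_imagUnit (F : Type)) (aOf j)) (lineDelta_ne_zero (imagUnit_ne_zero (F : Type)) (aOf j))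
              (lineDelta_mul_self (imagUnit_mul_self (F : Type)) (aOf j)) x (realDiagonal (F : Type) dV hdV) (realDiagonal_isSymm (F : Type) dV hdV) (isUnit_det_realDiagonal (F : Type) dV hdV hdV0) hx
              (lineTransportSection ↥(maximalRealSubfield (F : Type)) (F : Type) (IsCMField.complexConj (F : Type)) 3 (complexConj_imagUnit (F : Type)) (imagUnit_ne_zero (F : Type)) (imagUnit_mul_self (F : Type)) (realDiagonal (F : Type) dV hdV) (realDiagonal_isSymm (F : Type) dV hdV) (Matrix.diagonal dV) (realDiagonal_map (F : Type) dV hdV).symm (aOf i) v ((OmegaChiSplitting.chiLocalSplittingsD ⟨HodgeCM.CMField.K F⟩ e₁ dV hdV hdV0 (toHeckeCharacter (F : Type) (ψ i)) ((isOscillatorChar_toHeckeCharacter_iff (ψ i)).mpr (hψ i)) (aOf i)).s v) ((OmegaChiSplitting.chiLocalSplittingsD ⟨HodgeCM.CMField.K F⟩ e₁ dV hdV hdV0 (toHeckeCharacter (F : Type) (ψ i)) ((isOscillatorChar_toHeckeCharacter_iff (ψ i)).mpr (hψ i)) (aOf i)).proj_s v)) =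
            (lineTransportSection ↥(maximalRealSubfield (F : Type)) (F : Type) (IsCMField.complexConj (F : Type)) 3 (complexConj_imagUnit (F : Type)) (imagUnit_ne_zero (F : Type)) (imagUnit_mul_self (F : Type)) (realDiagonal (F : Type) dV hdV) (realDiagonal_isSymm (F : Type) dV hdV) (Matrix.diagonal dV) (realDiagonal_map (F : Type) dV hdV).symm (aOf j) v ((OmegaChiSplitting.chiLocalSplittingsD ⟨HodgeCM.CMField.K F⟩ e₁ dV hdV hdV0 (toHeckeCharacter (F : Type) (ψ i)) ((isOscillatorChar_toHeckeCharacter_iff (ψ i)).mpr (hψ i)) (aOf j)).s v) ((OmegaChiSplitting.chiLocalSplittingsD ⟨HodgeCM.CMField.K F⟩ e₁ dV hdV hdV0 (toHeckeCharacter (F : Type) (ψ i)) ((isOscillatorChar_toHeckeCharacter_iff (ψ i)).mpr (hψ i)) (aOf j)).proj_s v)))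
    (hc1 : Literature.RepresentationTheory.MoeglinVignerasWaldspurger1987.rankOne_theta_lines_disjoint)
    (hc3 : Literature.RepresentationTheory.MoeglinVignerasWaldspurger1987.rankOne_theta_twist_rigidity) :
    Summit.HodgeConjecture.HodgeConjecture.Theses.HCCMUnconditional.HD3 :=
  hypD3_of_facts
    (fun F dV hdV hdV0 {_ι} ψ hψ aOf _χOf v i j =>
      kudla_of_lineRigidity F dV hdV hdV0 ψ hψ aOf v i j (hS6a F dV hdV hdV0 ψ hψ aOf v i j))
    (isoOfParams_of_lineRigidityS6a hS6a) hc1 hc3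

end Summit.HodgeConjecture.CorCM.HypD3

end
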